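import Summits.QuantumFields.YangMills.Theses.FradkinShenkerFlow

/-!
# `SusceptibilityToPoincare` — restatement package (line `rg-variance-cascade`, lead c4, cycle 3)

Support for crux `stmt-QuantumFields-9441` (`Summit.QuantumFields.YangMills.Theses.FradkinShenkerFlow.SusceptibilityToPoincare`,
FS ⇒ UP for every compact simple `G`, faithful unitary `r`, `β ≥ 0`).  Eight lead seats, the disprovers (p76563, p77766),
both round-2 ideators and all round-2 triagers concur that the decl AS TYPED is refuted modulo the standing 't Hooft twist
inputs on both sides of the `π₁` cut, every line reducing it to the same residual, and that its buildable content is the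
weak-coupling simply-connected core
  C″ : `IsCompactSimpleLieGroup G → SimplyConnectedSpace G → ∀ r, ∃ β₁, ∀ β ≥ β₁, FS r β → UP r β`.
This file is the kernel-checked form of that verdict and of the proposed repair, in the vocabulary of the route file
(registered rider stubs of the skeleton `Cruxes/SusceptibilityToPoincare/Lines/rg_variance_cascade.lean` v2.5, §6):

* `crux_iff_coreSC_and_residual` — **9441 as typed ⟺ C″ ∧ T**, where T ("the typed decl follows from its simply-connected
  weak-coupling core") is the scope sentinel of the skeleton, refuted modulo the twist inputs on both halves by the landed
  `Negative/TypedDeclResidualFalseOfTwistInputs.lean`: restating 9441 as C″ deletes exactly T;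
* `nonSimplyConnectedClustering_of_crux` — the centreless companion **N** : `IsCompactSimpleLieGroup G →
  ¬ SimplyConnectedSpace G → ∀ r, ∃ β₁, ∀ β ≥ β₁, FS r β → EC r β` (clustering currency, immune to the twist sectors) follows
  from 9441 as typed and the PROVED item 9444 `PoincareToClustering` — so the pair (C″, N) is a pure weakening of (9441, 9444);
* `closes_restated` — **C″ → N → PoincareToClustering → FiniteSusceptibilityWeakCoupling → ClusteringToYangMills → YangMills**:
  the route's deciding theorem with 9441 replaced by (C″, N) and the other three items unchanged (case split on
  `SimplyConnectedSpace G`; thresholds absorbed by `max`) — the pattern of the ConvexGribovBody repair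
  (`BrascampLiebVacuumSC` stmt-16404 + `NonSimplyConnectedLatticeGap` stmt-16405).

Pure logic over the route's definitions; FS / UP / EC are spelled verbatim (`wilsonMeasure (d := 4) (L := 2 * S + 1) r.ρ β`
in its ascription spelling `(wilsonMeasure r.ρ β : Measure (GaugeConfig 4 (2 * S + 1) G))`, the same term).
-/

noncomputable section

open MeasureTheory ProbabilityTheory Filter Topology
open Literature.MathematicalPhysics.QuantumFieldTheory

namespace Summit.QuantumFields.YangMills.Theorems.SusceptibilityToPoincare.Restatement

/-- **9441 as typed ⟺ (C″ ∧ T).**  (→): C″ with `β₁ := 0`, and T because its conclusion is the decl's body; (←): for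
`G, r, β ≥ 0` with FS, T applied to the core C″ (its hypothesis) returns UP.  Restating the crux as C″ therefore removes
exactly the sentinel T, refuted modulo the standing twist inputs (`Negative.typedDeclResidual_false_of_twistInputs_centreless`,
`Negative.typedDeclResidual_false_of_twistInputsSU2`). [folklore] -/
theorem crux_iff_coreSC_and_residual :
    Summit.QuantumFields.YangMills.Theses.FradkinShenkerFlow.SusceptibilityToPoincare ↔
      ((∀ (G : Type) [Group G] [TopologicalSpace G] [IsTopologicalGroup G] [CompactSpace G]
        [MeasurableSpace G] [BorelSpace G], IsCompactSimpleLieGroup G → SimplyConnectedSpace G →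
        ∀ (r : LatticeRep G), ∃ β₁ : ℝ, ∀ β : ℝ, β₁ ≤ β →
        (∀ A B : YMSpecies G, ∃ χ : ℝ, ∀ S : ℕ, ∑ x ∈ Literature.Probability.LatticeModels.box 4 S,
          |covariance (fun U => A.F (Literature.MathematicalPhysics.QuantumLattice.torusLift (2 * S + 1) U))
            (fun U => B.F (Literature.MathematicalPhysics.QuantumLattice.configShift (-x)
            (Literature.MathematicalPhysics.QuantumLattice.torusLift (2 * S + 1) U)))
            (wilsonMeasure r.ρ β : Measure (GaugeConfig 4 (2 * S + 1) G))| ≤ χ) →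
        (∃ C : ℝ, ∀ S : ℕ, ∀ F : GaugeConfig 4 (2 * S + 1) G → ℝ, Measurable F → (∃ M : ℝ, ∀ U, |F U| ≤ M) →
          variance F (wilsonMeasure r.ρ β : Measure (GaugeConfig 4 (2 * S + 1) G)) ≤
            C * ∑ ℓ : Edge 4 (2 * S + 1), ∫ U, ∫ g, (F U - F (Function.update U ℓ g)) ^ 2
              ∂((haarProbability G).tilted (fun g' => -β * wilsonAction r.ρ (Function.update U ℓ g')))
              ∂(wilsonMeasure r.ρ β : Measure (GaugeConfig 4 (2 * S + 1) G)))) ∧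
      (∀ (G : Type) [Group G] [TopologicalSpace G] [IsTopologicalGroup G] [CompactSpace G]
        [MeasurableSpace G] [BorelSpace G], IsCompactSimpleLieGroup G → ∀ (r : LatticeRep G),
        (SimplyConnectedSpace G → ∃ β₁ : ℝ, ∀ β : ℝ, β₁ ≤ β →
        (∀ A B : YMSpecies G, ∃ χ : ℝ, ∀ S : ℕ, ∑ x ∈ Literature.Probability.LatticeModels.box 4 S,
          |covariance (fun U => A.F (Literature.MathematicalPhysics.QuantumLattice.torusLift (2 * S + 1) U))
            (fun U => B.F (Literature.MathematicalPhysics.QuantumLattice.configShift (-x)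
            (Literature.MathematicalPhysics.QuantumLattice.torusLift (2 * S + 1) U)))
            (wilsonMeasure r.ρ β : Measure (GaugeConfig 4 (2 * S + 1) G))| ≤ χ) →
        (∃ C : ℝ, ∀ S : ℕ, ∀ F : GaugeConfig 4 (2 * S + 1) G → ℝ, Measurable F → (∃ M : ℝ, ∀ U, |F U| ≤ M) →
          variance F (wilsonMeasure r.ρ β : Measure (GaugeConfig 4 (2 * S + 1) G)) ≤
            C * ∑ ℓ : Edge 4 (2 * S + 1), ∫ U, ∫ g, (F U - F (Function.update U ℓ g)) ^ 2
              ∂((haarProbability G).tilted (fun g' => -β * wilsonAction r.ρ (Function.update U ℓ g')))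
              ∂(wilsonMeasure r.ρ β : Measure (GaugeConfig 4 (2 * S + 1) G)))) →
        ∀ β : ℝ, 0 ≤ β →
        (∀ A B : YMSpecies G, ∃ χ : ℝ, ∀ S : ℕ, ∑ x ∈ Literature.Probability.LatticeModels.box 4 S,
          |covariance (fun U => A.F (Literature.MathematicalPhysics.QuantumLattice.torusLift (2 * S + 1) U))
            (fun U => B.F (Literature.MathematicalPhysics.QuantumLattice.configShift (-x)
            (Literature.MathematicalPhysics.QuantumLattice.torusLift (2 * S + 1) U)))
            (wilsonMeasure r.ρ β : Measure (GaugeConfig 4 (2 * S + 1) G))| ≤ χ) →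
        (∃ C : ℝ, ∀ S : ℕ, ∀ F : GaugeConfig 4 (2 * S + 1) G → ℝ, Measurable F → (∃ M : ℝ, ∀ U, |F U| ≤ M) →
          variance F (wilsonMeasure r.ρ β : Measure (GaugeConfig 4 (2 * S + 1) G)) ≤
            C * ∑ ℓ : Edge 4 (2 * S + 1), ∫ U, ∫ g, (F U - F (Function.update U ℓ g)) ^ 2
              ∂((haarProbability G).tilted (fun g' => -β * wilsonAction r.ρ (Function.update U ℓ g')))
              ∂(wilsonMeasure r.ρ β : Measure (GaugeConfig 4 (2 * S + 1) G))))) := by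
  constructor
  · intro h
    exact ⟨fun G _ _ _ _ _ _ hG _ r => ⟨0, fun β hβ hFS => h G hG r β hβ hFS⟩,
      fun G _ _ _ _ _ _ hG r _ β hβ hFS => h G hG r β hβ hFS⟩
  · rintro ⟨hC, hT⟩ G _ _ _ _ _ _ hG r β hβ hFS
    exact hT G hG r (fun hsc => hC G hG hsc r) β hβ hFS

/-- **The centreless companion N follows from 9441 as typed and item 9444** (`β₁ := 0`; FS ⇒ UP by the crux, UP ⇒ EC by
`PoincareToClustering`): the proposed pair (C″, N) is implied by the route's present items. [folklore] -/
theorem nonSimplyConnectedClustering_of_crux :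
    Summit.QuantumFields.YangMills.Theses.FradkinShenkerFlow.SusceptibilityToPoincare →
    Summit.QuantumFields.YangMills.Theses.FradkinShenkerFlow.PoincareToClustering →
    (∀ (G : Type) [Group G] [TopologicalSpace G] [IsTopologicalGroup G] [CompactSpace G]
        [MeasurableSpace G] [BorelSpace G], IsCompactSimpleLieGroup G → ¬ SimplyConnectedSpace G →
        ∀ (r : LatticeRep G), ∃ β₁ : ℝ, ∀ β : ℝ, β₁ ≤ β →
        (∀ A B : YMSpecies G, ∃ χ : ℝ, ∀ S : ℕ, ∑ x ∈ Literature.Probability.LatticeModels.box 4 S,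
          |covariance (fun U => A.F (Literature.MathematicalPhysics.QuantumLattice.torusLift (2 * S + 1) U))
            (fun U => B.F (Literature.MathematicalPhysics.QuantumLattice.configShift (-x)
            (Literature.MathematicalPhysics.QuantumLattice.torusLift (2 * S + 1) U)))
            (wilsonMeasure r.ρ β : Measure (GaugeConfig 4 (2 * S + 1) G))| ≤ χ) →
        (∃ m : ℝ, 0 < m ∧ ∀ A B : YMSpecies G, ∃ C : ℝ, ∀ S n : ℕ, n ≤ S →
          |latticeConnectedCorr r.ρ β (2 * S + 1) A.F B.F n| ≤ C * Real.exp (-(m * n)))) := by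
  intro h hPC G _ _ _ _ _ _ hG _ r
  exact ⟨0, fun β hβ hFS => hPC G r β hβ (h G hG r β hβ hFS)⟩

/-- **The restated route closes.**  With 9441 replaced by the pair (C″, N), the deciding theorem of route
FradkinShenkerFlow goes through with the same three other items: for simply-connected `G`, FS (9442, threshold `β₀`) ⇒ UP
(C″, threshold `β₁`) ⇒ EC (9444) for `β ≥ max (max β₀ β₁) 0`; for centreless `G`, FS ⇒ EC by N for `β ≥ max β₀ β₁`; then
`ClusteringToYangMills` (9443).  Case split on the proposition `SimplyConnectedSpace G` (classical). [folklore] -/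
theorem closes_restated :
    (∀ (G : Type) [Group G] [TopologicalSpace G] [IsTopologicalGroup G] [CompactSpace G]
        [MeasurableSpace G] [BorelSpace G], IsCompactSimpleLieGroup G → SimplyConnectedSpace G →
        ∀ (r : LatticeRep G), ∃ β₁ : ℝ, ∀ β : ℝ, β₁ ≤ β →
        (∀ A B : YMSpecies G, ∃ χ : ℝ, ∀ S : ℕ, ∑ x ∈ Literature.Probability.LatticeModels.box 4 S,
          |covariance (fun U => A.F (Literature.MathematicalPhysics.QuantumLattice.torusLift (2 * S + 1) U))
            (fun U => B.F (Literature.MathematicalPhysics.QuantumLattice.configShift (-x)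
            (Literature.MathematicalPhysics.QuantumLattice.torusLift (2 * S + 1) U)))
            (wilsonMeasure r.ρ β : Measure (GaugeConfig 4 (2 * S + 1) G))| ≤ χ) →
        (∃ C : ℝ, ∀ S : ℕ, ∀ F : GaugeConfig 4 (2 * S + 1) G → ℝ, Measurable F → (∃ M : ℝ, ∀ U, |F U| ≤ M) →
          variance F (wilsonMeasure r.ρ β : Measure (GaugeConfig 4 (2 * S + 1) G)) ≤
            C * ∑ ℓ : Edge 4 (2 * S + 1), ∫ U, ∫ g, (F U - F (Function.update U ℓ g)) ^ 2
              ∂((haarProbability G).tilted (fun g' => -β * wilsonAction r.ρ (Function.update U ℓ g')))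
              ∂(wilsonMeasure r.ρ β : Measure (GaugeConfig 4 (2 * S + 1) G)))) →
    (∀ (G : Type) [Group G] [TopologicalSpace G] [IsTopologicalGroup G] [CompactSpace G]
        [MeasurableSpace G] [BorelSpace G], IsCompactSimpleLieGroup G → ¬ SimplyConnectedSpace G →
        ∀ (r : LatticeRep G), ∃ β₁ : ℝ, ∀ β : ℝ, β₁ ≤ β →
        (∀ A B : YMSpecies G, ∃ χ : ℝ, ∀ S : ℕ, ∑ x ∈ Literature.Probability.LatticeModels.box 4 S,
          |covariance (fun U => A.F (Literature.MathematicalPhysics.QuantumLattice.torusLift (2 * S + 1) U))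
            (fun U => B.F (Literature.MathematicalPhysics.QuantumLattice.configShift (-x)
            (Literature.MathematicalPhysics.QuantumLattice.torusLift (2 * S + 1) U)))
            (wilsonMeasure r.ρ β : Measure (GaugeConfig 4 (2 * S + 1) G))| ≤ χ) →
        (∃ m : ℝ, 0 < m ∧ ∀ A B : YMSpecies G, ∃ C : ℝ, ∀ S n : ℕ, n ≤ S →
          |latticeConnectedCorr r.ρ β (2 * S + 1) A.F B.F n| ≤ C * Real.exp (-(m * n)))) →
    Summit.QuantumFields.YangMills.Theses.FradkinShenkerFlow.PoincareToClustering →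
    Summit.QuantumFields.YangMills.Theses.FradkinShenkerFlow.FiniteSusceptibilityWeakCoupling →
    Summit.QuantumFields.YangMills.Theses.FradkinShenkerFlow.ClusteringToYangMills → YangMills := by
  intro hSC hN hPC hFS hCY
  refine hCY ?_
  intro G _ _ _ _ _ _ hG r
  obtain ⟨β₀, hβ₀⟩ := hFS G hG r
  by_cases hsc : SimplyConnectedSpace G
  · obtain ⟨β₁, hβ₁⟩ := hSC G hG hsc r
    refine ⟨max (max β₀ β₁) 0, fun β hβ => ?_⟩
    have h0 : (0 : ℝ) ≤ β := le_trans (le_max_right _ _) hβ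
    have hb₀ : β₀ ≤ β := le_trans ((le_max_left _ _).trans (le_max_left _ _)) hβ
    have hb₁ : β₁ ≤ β := le_trans ((le_max_right _ _).trans (le_max_left _ _)) hβ
    exact hPC G r β h0 (hβ₁ β hb₁ (hβ₀ β hb₀))
  · obtain ⟨β₁, hβ₁⟩ := hN G hG hsc r
    exact ⟨max β₀ β₁, fun β hβ =>
      hβ₁ β (le_trans (le_max_right _ _) hβ) (hβ₀ β (le_trans (le_max_left _ _) hβ))⟩

end Summit.QuantumFields.YangMills.Theorems.SusceptibilityToPoincare.Restatement

end
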